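import Literature.NumberTheory.LFunctions.SiegelTatuzawaHoffsteinLemma
import Literature.NumberTheory.LFunctions.ExplicitLandauRepulsionStechkin
import HarnessLib

/-!
# Hoffstein's Lemma 3 (Acta Arith. 38 (1980), p. 170) — the discharge of `hoffstein1980_lemma3`

Topic `Literature/NumberTheory/LFunctions`. Everything in this file is PROVED; its last theorem is
`Literature.NumberTheory.LFunctions.hoffstein1980_lemma3_holds : hoffstein1980_lemma3`, discharging
the named fact of `SiegelTatuzawaExplicit.lean`:

> **Lemma 3** (J. Hoffstein, *On the Siegel–Tatuzawa theorem*, Acta Arith. **38** (1980) 167–174,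
> p. 170). "Let `d, d′`, `|d| ≥ |d′| ≥ 10⁶` be the discriminants of two quadratic fields and let
> `L(s, χ)`, `L(s, χ′)` be the corresponding `L`-series. If `L(s, χ′)` has a real zero `β′`, then
> `1 − β′ > 1/(5.828 log|dd′|)` or `L(1, χ) > 1/(7.735 log|d|)`."

## The printed proof and the proof given here

Printed proof (p. 170): "Let `K = Q(√d, √d′)`. Then `ζ_K(s) = ζ(s)L(s,χ)L(s,χ′)L(s,χχ′)`. If
`L(s,χ) ≠ 0` on the interval `(1 − 1/11.657 log|d|, 1)` then by Lemma 1 the result follows. If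
`L(β,χ) = 0` for some `β` in that interval then both `β` and `β′` are zeros of `ζ_K(s)` so by Lemma 2
`1 − β′ > 1/(2.9142 log|D_K|)` or `1 − β > 1/(2.9142 log|D_K|)`. But `D_K | (dd′)²` and `|d| ≥ |d′|`
so `2.9142 log|D_K| ≤ 11.657 log|d|`. Thus the lower bound for `1 − β′` must hold."

We follow the same dichotomy.

* **Second case** (a zero `β` of `L(s,χ)` with `1 − β ≤ 1/(11.657 log q)`). Hoffstein's Lemma 2
  (`hoffstein1980_lemma2`, Stark's inequality for the Dedekind zeta function of an arbitrary number
  field) is NOT used: for the biquadratic field the two zeros `β`, `β′` belong to the two DISTINCT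
  real primitive characters `χ`, `χ′`, which is exactly the situation of the explicit Landau theorem
  of McCurley (J. Number Theory 19 (1984), Theorem 2) — a KERNEL THEOREM of the tree
  (`McCurley1984_theorem2_holds`, file `ExplicitLandauRepulsionStechkin.lean`):
  `min{β, β′} < 1 − c/log max{qq′/17, 13}` with `c = (15 − 10√2)/(5 − √5) = 0.3103…`
  (`ThornerZaman2024.landauConst`). Since `log max{qq′/17, 13} ≤ log(qq′) ≤ 2 log q` and
  `2/11.657 = 0.1716 < c`, the zero `β` lies inside McCurley's window, so `β′` lies outside it:
  `1 − β′ > c/log(qq′) > 1/(5.828 log(qq′))` (`1/5.828 = 0.17159 < 0.31 < c`). McCurley's constant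
  is STRONGER than Hoffstein's `1/5.828 = 1/(2·2.9142)` (Stark's `3/2 + √2` halved by
  `|D_K| ≤ (dd′)²`), so the printed alternative follows a fortiori.
* **First case** (`L(s,χ) ≠ 0` on `[1 − 1/(11.657 log q), 1)`). The print invokes Lemma 1, whose
  first assertion gives `L(1,χ) > 1.507(1 − β)` for `1 − β < 1/(11.657 log q)`; at the edge of the
  window this yields only `L(1,χ) ≥ 1.507/(11.657 log q) = 1/(7.7352… log q)`, a hair BELOW the printed
  `1/(7.735 log q)` (the source rounds `11.657/1.507 = 7.7352…` to `7.735`). The gap is closed here by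
  re-running the PROVED master inequality of the Lemma-1 file (`Hoffstein1980.hoffstein_master`, the
  formal version of p. 169 (1)–(3)) at `β = 1 − 1/(11.657 log q)`, `x = q^{14/15}`, which actually
  gives `L(1,χ) ≥ 1.511 (1 − β)` (the kernel numerics of the Lemma-1 file have this slack:
  `e^{−(14/15)/11.657} · (Σ_{m≤200} m⁻² − 1.2·10⁸/x²) − 0.0016 ≥ 0.92305·1.6387 − 0.0016 > 1.511`),
  whence `L(1,χ) ≥ 1.511/(11.657 log q) > 1/(7.735 log q)` (`Hoffstein1980.lOne_gt_of_ne_zero_window`).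
  The threshold is used as `q ≥ 10⁶` (the fact carries `10⁶ ≤ q′ ≤ q`), which is all the numerics need.

No new definitions, no named facts; net named-fact debt −1.

Also proved here, from the same master inequality: `Hoffstein1980.lOne_gt_of_re_nonneg` (Lemma 1 (3)
with the kernel's slack: `q ≥ 10⁶`, `β < 1`, `1 − β ≤ 1/(11.657 log q)`, `L(β,χ) ≥ 0` ⟹
`L(1,χ) > 1.511(1 − β)`) and `Hoffstein1980.exists_realZero_of_lOne_le` — the paper's step (5) ⇒ (6)
(p. 170) together with the first line of §4 (p. 172, "let `β` denote the largest such zero"): if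
`L(1,χ) ≤ 1/(7.735 log q)` then `L(s,χ)` has a LARGEST real zero `β ∈ [1 − 1/(11.657 log q), 1)` and
`L(1,χ) > 1.511(1 − β)` — an explicit converse-Hecke statement in Hoffstein's constants (compare the
tree's `RealZeroRepulsion.exists_realZero_of_lOne_lt` (`RealZeroLOneLowerBoundExplicit.lean`): threshold `1/(8 log q)`, window
`1/(4 log q)`, ratio `0.32`, for `q ≥ 10⁴`).
Its class-number reading `exists_realZero_dedekindZeta_of_classNumber_le` (p. 173 (17) context):
an imaginary quadratic `K` with `|d_K| ≥ 10⁶` and `h_K ≤ √|d_K|/(7.735 π log|d_K|)` has `ζ_K(β) = 0` for a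
largest real `β ∈ [1 − 1/(11.657 log|d_K|), 1)`, with `1.511(1 − β) < π h_K/√|d_K|`.
In Tao–Teräväinen's currency (`Literature.Barriers.Parity.IsSiegelZero χ η`: `L(1 − 1/(η log q), χ) = 0`,
`η ≥ 10`): `Hoffstein1980.exists_isSiegelZero_of_lOne_le` — `|L(1,χ)| ≤ 1/(7.735 log q)`, `q ≥ 10⁶` ⟹ a
Siegel zero of quality `η ≥ 11.657` with `|L(1,χ)| > 1.511/(η log q)` (the tree's kernel dictionary
`SiegelZeroPredicateDictionary` needs `|L(1,χ)| log q ≤ 0.032`; this reaches `≤ 0.1292`).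

## References

* J. Hoffstein, *On the Siegel–Tatuzawa theorem*, Acta Arith. 38 (1980) 167–174: Lemma 3 and its
  proof p. 170; Lemma 1 p. 168 and its proof p. 169. [Hoffstein1980SiegelTatuzawa]
* K. S. McCurley, *Explicit zero-free regions for Dirichlet L-functions*, J. Number Theory 19 (1984)
  7–32, Theorem 2. [McCurley1984ZFR]
* H. M. Stark, *Some effective cases of the Brauer–Siegel theorem*, Invent. Math. 23 (1974) 135–152,
  Lemma 3 (the input of the printed proof, replaced here by McCurley's theorem). [Stark1974]
-/

noncomputable section

open Complex Set Filter Topology DirichletCharacter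
open scoped Real

namespace Literature.NumberTheory.LFunctions

namespace Hoffstein1980

variable {q : ℕ} [NeZero q] {χ : DirichletCharacter ℂ q}

/-! ### Numerical lemmas -/

/-- `√2 < 1.41422`. [folklore] -/
private lemma sqrt_two_lt' : Real.sqrt 2 < 1.41422 := by
  rw [show (1.41422 : ℝ) = Real.sqrt (1.41422 ^ 2) by rw [Real.sqrt_sq (by norm_num)]]
  exact Real.sqrt_lt_sqrt (by norm_num) (by norm_num)

/-- `2.236 < √5`. [folklore] -/
private lemma sqrt_five_gt' : (2.236 : ℝ) < Real.sqrt 5 := by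
  rw [show (2.236 : ℝ) = Real.sqrt (2.236 ^ 2) by rw [Real.sqrt_sq (by norm_num)]]
  exact Real.sqrt_lt_sqrt (by norm_num) (by norm_num)

/-- `√5 < 2.237`. [folklore] -/
private lemma sqrt_five_lt' : Real.sqrt 5 < 2.237 := by
  rw [show (2.237 : ℝ) = Real.sqrt (2.237 ^ 2) by rw [Real.sqrt_sq (by norm_num)]]
  exact Real.sqrt_lt_sqrt (by norm_num) (by norm_num)

/-- McCurley's `1/R₁ = (15 − 10√2)/(5 − √5)` exceeds `0.31` (it is `0.3103…`); in particular it
exceeds Hoffstein's `1/5.828 = 0.1715…` and `2/11.657 = 0.1715…`.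
[cite: McCurley1984ZFR, Theorem 2] -/
theorem landauConst_gt : (0.31 : ℝ) < ThornerZaman2024.landauConst := by
  unfold ThornerZaman2024.landauConst
  have h2 := sqrt_two_lt'
  have h5 := sqrt_five_gt'
  have h5' := sqrt_five_lt'
  rw [lt_div_iff₀ (by linarith)]
  nlinarith

/-- `log r > 19 log 2 > 13.1697` for `r ≥ 10⁶`. [folklore] -/
private lemma log_gt_of_ge_ten6 {r : ℝ} (hr : 10 ^ 6 ≤ r) : (13.1697 : ℝ) < Real.log r := by
  have h19 : Real.log ((2 : ℝ) ^ 19) < Real.log r :=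
    Real.log_lt_log (by positivity) (by linarith [show ((2 : ℝ) ^ 19) < 10 ^ 6 by norm_num])
  rw [Real.log_pow] at h19
  push_cast at h19
  linarith [Real.log_two_gt_d9]

/-- `r ≥ 10⁶`, `e ≥ 0` ⟹ `r^e ≥ 10^{6e}`. [folklore] -/
private lemma rpow_ge_of_ge_ten6 {r : ℝ} (hr : 10 ^ 6 ≤ r) {e : ℝ} (he : 0 ≤ e) :
    (10 : ℝ) ^ (6 * e) ≤ r ^ e := by
  calc (10 : ℝ) ^ (6 * e) = ((10 : ℝ) ^ (6 : ℕ)) ^ e := by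
        rw [show (6 : ℝ) * e = ((6 : ℕ) : ℝ) * e by norm_num, Real.rpow_natCast_mul (by norm_num)]
    _ ≤ r ^ e := Real.rpow_le_rpow (by norm_num) hr he

/-- `r ≥ 10⁶`, `e ≥ 0` ⟹ `r^{−e} ≤ 10^{−6e}`. [folklore] -/
private lemma rpow_le_of_ge_ten6 {r : ℝ} (hr : 10 ^ 6 ≤ r) {e : ℝ} (he : 0 ≤ e) :
    r ^ (-e) ≤ (10 : ℝ) ^ (-(6 * e)) := by
  have hr0 : 0 < r := lt_of_lt_of_le (by norm_num) hr
  rw [Real.rpow_neg hr0.le, Real.rpow_neg (by norm_num)]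
  exact inv_anti₀ (by positivity) (rpow_ge_of_ge_ten6 hr he)

/-- `e^{−(14/15)/11.657} ≥ 0.92305` (Taylor to order 3). [folklore] -/
private lemma exp_window_ge : (0.92305 : ℝ) ≤ Real.exp (-(14 / 15 / 11.657)) := by
  have h := Real.exp_bound (x := -(14 / 15 / 11.657 : ℝ)) (by rw [abs_le]; constructor <;> norm_num)
    (n := 4) (by norm_num)
  rw [abs_le] at h
  have h2 := h.1
  simp only [Finset.sum_range_succ, Finset.sum_range_zero, Nat.factorial, Nat.succ_eq_add_one] at h2
  norm_num at h2
  linarith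

/-- A primitive character to a modulus `q > 1` is not the trivial character (whose conductor is `1`).
[folklore] -/
private lemma ne_one_of_isPrimitive_of_one_lt (hχ : χ.IsPrimitive) (hq : 1 < q) : χ ≠ 1 := by
  rintro rfl
  have h1 : (1 : DirichletCharacter ℂ q).conductor = 1 := conductor_one
  have h2 : (1 : DirichletCharacter ℂ q).conductor = q := hχ
  omega

/-! ### Lemma 1, inequality (3), with the kernel's slack -/

open Literature.NumberTheory.LFunctions.DirichletAbel in
/-- **Lemma 1, first assertion, sharpened** (p. 169 (1)–(3) re-run): for a real primitive `χ` modulo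
`q ≥ 10⁶` and a real `β < 1` with `1 − β ≤ 1/(11.657 log q)` and `L(β, χ) ≥ 0` (in particular a ZERO
`β` of `L(s, χ)` in the window, or the edge of a zero-free window), `L(1, χ) > 1.511 (1 − β)`.
The master inequality (`Hoffstein1980.hoffstein_master`, p. 169 (1)–(2)) at `x = q^{14/15}` gives
`L(1,χ) ≥ (1 − β)(x^{−(1−β)} Σ_{m ≤ 200}(m⁻² − 15m²/x²) − E) ≥ (1 − β)(0.92305·1.6387 − 0.0016)`;
the print rounds the bracket to `1.507` ("(3) `L(1, χ) ≥ 1.507(1 − β)`", p. 169), the kernel numerics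
give `1.511`. (The print states (3) for a zero `β` with `1 − β < 1/(11.657 log|d|)`; only
`L(β, χ) ≥ 0` and the non-strict window bound are used.)
[cite: Hoffstein1980SiegelTatuzawa, Lemma 1 p. 168, proof p. 169 (1)–(3)] -/
theorem lOne_gt_of_re_nonneg (hχ : χ.IsPrimitive) (hquad : χ.IsQuadratic)
    (hq6 : (10 ^ 6 : ℝ) ≤ q) {β : ℝ} (hβ1 : β < 1) (hβw : 1 - β ≤ 1 / (11.657 * Real.log q))
    (hLβ : 0 ≤ (χ.LFunction β).re) :
    1.511 * (1 - β) < (χ.LFunction 1).re := by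
  have hq1r : (1 : ℝ) < q := lt_of_lt_of_le (by norm_num) hq6
  have hq : 1 < q := by exact_mod_cast hq1r
  have hq0 : (0 : ℝ) < q := by linarith
  have hlog := log_gt_of_ge_ten6 hq6
  have hlog0 : 0 < Real.log q := by linarith
  have hκ0 : 0 < 1 - β := by linarith
  have hκlog : (1 - β) * Real.log q ≤ 1 / 11.657 := by
    have h1 : (1 - β) * Real.log q ≤ 1 / (11.657 * Real.log q) * Real.log q :=
      mul_le_mul_of_nonneg_right hβw hlog0.le
    have h2 : 1 / (11.657 * Real.log q) * Real.log q = 1 / 11.657 := by field_simp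
    linarith
  have hκ1 : 1 - β < 0.0066 := by
    have h1 : (1 - β) * 13.1697 < (1 - β) * Real.log q := mul_lt_mul_of_pos_left hlog hκ0
    norm_num at h1 hκlog ⊢
    nlinarith
  have hβ0 : 1 / 2 < β := by linarith
  -- the choice `x = q^{14/15}`
  obtain ⟨x, hxdef⟩ : ∃ x : ℝ, x = (q : ℝ) ^ (14 / 15 : ℝ) := ⟨_, rfl⟩
  have hx0 : 0 < x := hxdef ▸ Real.rpow_pos_of_pos hq0 _
  have hx5 : (100000 : ℝ) ≤ x := by
    have h1 := rpow_ge_of_ge_ten6 hq6 (e := 14 / 15) (by norm_num)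
    have h2 : (10 : ℝ) ^ (5 : ℝ) ≤ (10 : ℝ) ^ (6 * (14 / 15) : ℝ) :=
      Real.rpow_le_rpow_of_exponent_le (by norm_num) (by norm_num)
    have h3 : (10 : ℝ) ^ (5 : ℝ) = 100000 := by
      rw [show (5 : ℝ) = ((5 : ℕ) : ℝ) by norm_num, Real.rpow_natCast]; norm_num
    rw [hxdef]; linarith
  have hM := hoffstein_master hq hχ hquad hβ0 hβ1 hLβ (x := x) (by linarith)
  -- (i) `x^{-(1-β)} ≥ e^{-(14/15)/11.657} ≥ 0.92305`
  have hxκ : (0.92305 : ℝ) ≤ x ^ (-(1 - β)) := by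
    refine exp_window_ge.trans ?_
    rw [Real.rpow_def_of_pos hx0, Real.exp_le_exp, hxdef, Real.log_rpow hq0]
    have : 14 / 15 * Real.log q * (1 - β) ≤ 14 / 15 / 11.657 := by
      rw [mul_assoc, mul_comm (Real.log q)]
      have := mul_le_mul_of_nonneg_left hκlog (show (0 : ℝ) ≤ 14 / 15 by norm_num)
      linarith
    linarith
  -- (ii) the squares sum `≥ 1.6387`
  have hx2 : (10 : ℝ) ^ 11 ≤ x ^ 2 := by
    have h1 := rpow_ge_of_ge_ten6 hq6 (e := 2 * (14 / 15)) (by norm_num)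
    have h2 : (10 : ℝ) ^ (11 : ℝ) ≤ (10 : ℝ) ^ (6 * (2 * (14 / 15)) : ℝ) :=
      Real.rpow_le_rpow_of_exponent_le (by norm_num) (by norm_num)
    have h3 : (10 : ℝ) ^ (11 : ℝ) = 10 ^ 11 := by
      rw [show (11 : ℝ) = ((11 : ℕ) : ℝ) by norm_num, Real.rpow_natCast]
    have h4 : x ^ 2 = (q : ℝ) ^ (2 * (14 / 15) : ℝ) := by
      rw [hxdef, ← Real.rpow_natCast, ← Real.rpow_mul hq0.le]; norm_num
    rw [h4]; linarith
  have hSm : (1.6387 : ℝ) ≤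
      ∑ m ∈ Finset.range 200, (1 / ((m : ℝ) + 1) ^ 2 - 15 * ((m : ℝ) + 1) ^ 2 / x ^ 2) := by
    rw [Finset.sum_sub_distrib]
    have hA := sum_inv_sq_200_ge
    -- each subtracted term is at most `15·200²/x²`, and `200·15·200²/x² ≤ 1.2·10⁸/10¹¹`
    have hB : ∑ m ∈ Finset.range 200, 15 * ((m : ℝ) + 1) ^ 2 / x ^ 2 ≤
        ∑ _m ∈ Finset.range 200, (15 * 200 ^ 2 / x ^ 2 : ℝ) := by
      refine Finset.sum_le_sum fun m hm ↦ ?_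
      have hm200 : (m : ℝ) + 1 ≤ 200 := by
        have := Finset.mem_range.1 hm
        have : (m : ℝ) + 1 ≤ ((200 : ℕ) : ℝ) := by exact_mod_cast this
        simpa using this
      have hx2pos : 0 < x ^ 2 := by positivity
      gcongr
    rw [Finset.sum_const, Finset.card_range, nsmul_eq_mul] at hB
    have hC : (200 : ℕ) * (15 * 200 ^ 2 / x ^ 2 : ℝ) ≤ 0.0012 := by
      push_cast
      rw [← mul_div_assoc, div_le_iff₀ (by positivity)]
      linarith
    linarith
  -- (iii) the error term `≤ 0.001584`
  have hE : hoffErrConst q (1 - β) * x ^ (-(5 / 2 : ℝ)) ≤ 0.001584 := by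
    have hC := hoffErrConst_le hκ1.le (by norm_num) q
    have hnum : (45 * 1.9955 * ((5 / 4) / ((5 / 2 - 0.0066) * (1 / 2 - 0.0066))) /
        (2 * 97.4 * 2.958) : ℝ) ≤ 0.1584 := by norm_num
    have hx52 : x ^ (-(5 / 2 : ℝ)) = (q : ℝ) ^ (-(7 / 3 : ℝ)) := by
      rw [hxdef, ← Real.rpow_mul hq0.le]; norm_num
    have hq13 : (q : ℝ) ^ 2 * (q : ℝ) ^ (-(7 / 3 : ℝ)) = (q : ℝ) ^ (-(1 / 3 : ℝ)) := by
      rw [← Real.rpow_natCast, ← Real.rpow_add hq0]; norm_num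
    have hq13' : (q : ℝ) ^ (-(1 / 3 : ℝ)) ≤ 1 / 100 := by
      have := rpow_le_of_ge_ten6 hq6 (e := 1 / 3) (by norm_num)
      have h2 : (10 : ℝ) ^ (-(6 * (1 / 3)) : ℝ) = 1 / 100 := by
        rw [show (-(6 * (1 / 3)) : ℝ) = -((2 : ℕ) : ℝ) by norm_num, Real.rpow_neg (by norm_num),
          Real.rpow_natCast]; norm_num
      linarith
    have hCE0 : 0 ≤ (q : ℝ) ^ 2 * 0.1584 := by positivity
    calc hoffErrConst q (1 - β) * x ^ (-(5 / 2 : ℝ))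
        ≤ (q : ℝ) ^ 2 * 0.1584 * x ^ (-(5 / 2 : ℝ)) := by
          gcongr
          exact hC.trans (by gcongr)
      _ = 0.1584 * ((q : ℝ) ^ 2 * (q : ℝ) ^ (-(7 / 3 : ℝ))) := by rw [hx52]; ring
      _ ≤ 0.1584 * (1 / 100) := by rw [hq13]; gcongr
      _ = 0.001584 := by norm_num
  -- assembly: the bracket exceeds `1.511`
  have hprod : (0.92305 * 1.6387 : ℝ) ≤ x ^ (-(1 - β)) *
      ∑ m ∈ Finset.range 200, (1 / ((m : ℝ) + 1) ^ 2 - 15 * ((m : ℝ) + 1) ^ 2 / x ^ 2) :=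
    mul_le_mul hxκ hSm (by norm_num) (le_trans (by norm_num) hxκ)
  have hbr : (1.511 : ℝ) < x ^ (-(1 - β)) *
      ∑ m ∈ Finset.range 200, (1 / ((m : ℝ) + 1) ^ 2 - 15 * ((m : ℝ) + 1) ^ 2 / x ^ 2) -
      hoffErrConst q (1 - β) * x ^ (-(5 / 2 : ℝ)) := by
    norm_num at hprod ⊢; linarith
  have hL : (1 - β) * 1.511 < (χ.LFunction 1).re :=
    lt_of_lt_of_le (mul_lt_mul_of_pos_left hbr hκ0) hM
  linarith

/-! ### The first case: Lemma 1 at the edge of its window -/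

open Literature.NumberTheory.LFunctions.DirichletAbel in
/-- **Lemma 1 at the edge of the window, sharpened** (p. 169 (1)–(3) re-run): for a real primitive `χ`
modulo `q ≥ 10⁶`, if `L(σ, χ) ≠ 0` for real `σ ∈ [1 − 1/(11.657 log q), 1)`, then
`L(1, χ) > 1/(7.735 log q)`. (The master inequality at `β = 1 − 1/(11.657 log q)`, `x = q^{14/15}` gives
`L(1,χ) ≥ 1.511 (1 − β) = 1.511/(11.657 log q)`, and `11.657/7.735 = 1.507… < 1.511`.)
[cite: Hoffstein1980SiegelTatuzawa, Lemma 1 p. 168 and its proof p. 169; Lemma 3 proof p. 170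
("If L(s,χ) ≠ 0 on the interval (1 − 1/11.657 log|d|, 1) then by Lemma 1 the result follows")] -/
theorem lOne_gt_of_ne_zero_window (hχ : χ.IsPrimitive) (hquad : χ.IsQuadratic)
    (hq6 : (10 ^ 6 : ℝ) ≤ q)
    (hz : ∀ σ : ℝ, 1 - 1 / (11.657 * Real.log q) ≤ σ → σ < 1 → χ.LFunction σ ≠ 0) :
    1 / (7.735 * Real.log q) < (χ.LFunction 1).re := by
  have hq1r : (1 : ℝ) < q := lt_of_lt_of_le (by norm_num) hq6
  have hq : 1 < q := by exact_mod_cast hq1r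
  have hχ1 : χ ≠ 1 := ne_one_of_isPrimitive_of_one_lt hχ hq
  have hq2 : χ ^ 2 = 1 := hquad.sq_eq_one
  have hlog := log_gt_of_ge_ten6 hq6
  have hlog0 : 0 < Real.log q := by linarith
  -- the edge of the window
  set β : ℝ := 1 - 1 / (11.657 * Real.log q) with hβdef
  have hκ : 1 - β = 1 / (11.657 * Real.log q) := by rw [hβdef]; ring
  have hκ0 : 0 < 1 - β := by rw [hκ]; positivity
  have hβ1 : β < 1 := by linarith
  have hκlog : (1 - β) * Real.log q = 1 / 11.657 := by
    rw [hκ]; field_simp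
  have hκ1 : 1 - β < 0.0066 := by
    have h1 : (1 - β) * 13.1697 < (1 - β) * Real.log q := mul_lt_mul_of_pos_left hlog hκ0
    rw [hκlog] at h1
    norm_num at h1 ⊢
    linarith
  -- `L(β, χ) ≥ 0`: no zero on `[β, 1]`
  have hLβ : 0 ≤ (χ.LFunction β).re := by
    refine (LFunction_ofReal_re_pos_of_forall_ne_zero χ hχ1 hq2 (by linarith) hβ1.le
      fun σ h1 h2 ↦ ?_).le
    rcases eq_or_lt_of_le h2 with rfl | hlt
    · rw [ofReal_one]; exact LFunction_apply_one_ne_zero hχ1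
    · exact hz σ (by rw [hβdef] at h1; exact h1) hlt
  have hL := lOne_gt_of_re_nonneg hχ hquad hq6 hβ1 hκ.le hLβ
  -- `1/(7.735 log q) = (11.657/7.735)·(1 − β) < 1.511·(1 − β)`
  have hkey : 1 / (7.735 * Real.log q) = (1 - β) * (11.657 / 7.735) := by
    rw [hκ]; field_simp
  rw [hkey]
  refine lt_trans ?_ hL
  rw [mul_comm (1.511 : ℝ)]
  exact mul_lt_mul_of_pos_left (by norm_num) hκ0

/-! ### (5) ⇒ (6): a small `L(1, χ)` forces a real zero high in the window -/

/-- **Hoffstein's (5) ⇒ (6) (p. 170) with the first step of §4 (p. 172), in the kernel.** For a real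
primitive `χ` modulo `q ≥ 10⁶` with `L(1, χ) ≤ 1/(7.735 log q)` (print: "(5) `L(1, χ) ≤
(7.735 log|d|)⁻¹`"), `L(s, χ)` HAS a real zero `β` with `1 − 1/(11.657 log q) ≤ β < 1` (print, p. 170:
"by Lemma 1, `L(s, χ)` must have a real zero `β` satisfying (6) `L(1, χ) > 1.507(1 − β)`"; p. 172:
"Let `β` denote the largest such zero"), and for the LARGEST one — no zero of `L(σ, χ)` on `(β, 1)` —
`L(1, χ) > 1.511 (1 − β)` (print `1.507`; the kernel numerics of `lOne_gt_of_re_nonneg`). The zero is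
produced by `lOne_gt_of_ne_zero_window` (contrapositive) and maximised over the compact zero set of the
entire function `L(s, χ)` on `[1 − 1/(11.657 log q), 1]`.
[cite: Hoffstein1980SiegelTatuzawa, p. 170 (5)–(6); §4 p. 172] -/
theorem exists_realZero_of_lOne_le (hχ : χ.IsPrimitive) (hquad : χ.IsQuadratic)
    (hq6 : (10 ^ 6 : ℝ) ≤ q) (hL : (χ.LFunction 1).re ≤ 1 / (7.735 * Real.log q)) :
    ∃ β : ℝ, χ.LFunction β = 0 ∧ 1 - 1 / (11.657 * Real.log q) ≤ β ∧ β < 1 ∧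
      (∀ σ : ℝ, β < σ → σ < 1 → χ.LFunction σ ≠ 0) ∧ 1.511 * (1 - β) < (χ.LFunction 1).re := by
  have hq1r : (1 : ℝ) < q := lt_of_lt_of_le (by norm_num) hq6
  have hq : 1 < q := by exact_mod_cast hq1r
  have hχ1 : χ ≠ 1 := ne_one_of_isPrimitive_of_one_lt hχ hq
  set w : ℝ := 1 - 1 / (11.657 * Real.log q) with hwdef
  -- a zero in `[w, 1)` exists, by the first case
  have hex : ∃ σ : ℝ, w ≤ σ ∧ σ < 1 ∧ χ.LFunction σ = 0 := by
    by_contra! h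
    exact absurd (lOne_gt_of_ne_zero_window hχ hquad hq6 fun σ h1 h2 ↦ h σ h1 h2) (not_lt.2 hL)
  obtain ⟨σ₀, hσ₀w, hσ₀1, hσ₀z⟩ := hex
  -- the zero set on `[w, 1]` is compact; take its maximum
  set Z : Set ℝ := Set.Icc w 1 ∩ (fun σ : ℝ ↦ χ.LFunction σ) ⁻¹' {0} with hZdef
  have hcont : Continuous fun σ : ℝ ↦ χ.LFunction σ :=
    (differentiable_LFunction hχ1).continuous.comp continuous_ofReal
  have hZc : IsClosed Z := isClosed_Icc.inter (isClosed_singleton.preimage hcont)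
  have hZb : BddAbove Z := ⟨1, fun σ hσ ↦ hσ.1.2⟩
  have hσ₀Z : σ₀ ∈ Z := ⟨⟨hσ₀w, hσ₀1.le⟩, hσ₀z⟩
  have hZn : Z.Nonempty := ⟨σ₀, hσ₀Z⟩
  set β : ℝ := sSup Z with hβdef
  have hβZ : β ∈ Z := hZc.csSup_mem hZn hZb
  have hβz : χ.LFunction β = 0 := hβZ.2
  have hβw : w ≤ β := hβZ.1.1
  have hβ1 : β < 1 := by
    rcases eq_or_lt_of_le hβZ.1.2 with h1 | h1
    · exact absurd (by rw [← ofReal_one, ← h1]; exact hβz) (LFunction_apply_one_ne_zero hχ1)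
    · exact h1
  refine ⟨β, hβz, hβw, hβ1, fun σ h1 h2 hz ↦ ?_, ?_⟩
  · have hσZ : σ ∈ Z := ⟨⟨hβw.trans h1.le, h2.le⟩, hz⟩
    exact absurd (le_csSup hZb hσZ) (not_le.2 h1)
  · refine lOne_gt_of_re_nonneg hχ hquad hq6 hβ1 ?_ (by rw [hβz, zero_re])
    rw [hwdef] at hβw
    linarith

/-! ### (5) ⇒ (6) as a Siegel zero of quality `≥ 11.657` (Tao–Teräväinen's predicate) -/

/-- **`L(1, χ) ≤ 1/(7.735 log q)` ⇒ a Siegel zero of quality `η ≥ 11.657`** (Hoffstein's (5) ⇒ (6) in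
the currency of `Literature.Barriers.Parity.IsSiegelZero`, Tao–Teräväinen Definition 1.4:
`L(1 − 1/(η log q), χ) = 0`, `η ≥ 10`): for a primitive quadratic `χ` modulo `q ≥ 10⁶` with
`|L(1, χ)| ≤ 1/(7.735 log q)` there is `η ≥ 11.657` with `IsSiegelZero χ η` and
`|L(1, χ)| > 1.511/(η log q)` (`η = 1/((1 − β) log q)` for the largest zero `β` of
`exists_realZero_of_lOne_le`). This extends the tree's kernel dictionary
`RealZeroRepulsion.exists_isSiegelZero_of_lOne_mul_log_le` / `SiegelZeroPredicateDictionary`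
(which needs `|L(1, χ)| log q ≤ 0.032`) to the range `|L(1, χ)| log q ≤ 1/7.735 = 0.1292…` for `q ≥ 10⁶`.
[cite: Hoffstein1980SiegelTatuzawa, p. 170 (5)–(6)] [cite: TaoTeravainen2021, Definition 1.4] -/
theorem exists_isSiegelZero_of_lOne_le (hχ : χ.IsPrimitive) (hquad : χ.IsQuadratic)
    (hq6 : (10 ^ 6 : ℝ) ≤ q) (hL : ‖χ.LFunction 1‖ ≤ 1 / (7.735 * Real.log q)) :
    ∃ η : ℝ, 11.657 ≤ η ∧ Literature.Barriers.Parity.IsSiegelZero χ η ∧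
      1.511 / (η * Real.log q) < ‖χ.LFunction 1‖ := by
  have hq1r : (1 : ℝ) < q := lt_of_lt_of_le (by norm_num) hq6
  have hlog0 : 0 < Real.log q := Real.log_pos hq1r
  obtain ⟨β, hz, hβw, hβ1, -, hbound⟩ :=
    exists_realZero_of_lOne_le hχ hquad hq6 ((Complex.re_le_norm _).trans hL)
  have hκ0 : 0 < 1 - β := by linarith
  set η : ℝ := 1 / ((1 - β) * Real.log q) with hηdef
  have hη0 : 0 < η := by positivity
  have hηβ : 1 - 1 / (η * Real.log q) = β := by
    rw [hηdef]; field_simp; ring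
  have hη : 11.657 ≤ η := by
    have h1 : (1 - β) * Real.log q ≤ 1 / 11.657 := by
      have := mul_le_mul_of_nonneg_right hβw hlog0.le
      have h2 : 1 / (11.657 * Real.log q) * Real.log q = 1 / 11.657 := by field_simp
      linarith
    rw [hηdef, le_div_iff₀ (by positivity)]
    nlinarith
  refine ⟨η, hη, ⟨hχ, hquad, by linarith, by rw [hηβ]; exact hz⟩, ?_⟩
  have hkey : 1.511 / (η * Real.log q) = 1.511 * (1 - β) := by
    rw [hηdef]; field_simp
  rw [hkey]
  exact hbound.trans_le (Complex.re_le_norm _)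

end Hoffstein1980

/-! ### Lemma 3 -/

/-- **Hoffstein 1980, Lemma 3 — PROVED** (discharge of the named fact `hoffstein1980_lemma3`): for real
primitive `χ ≠ χ′` modulo `q ≥ q′ ≥ 10⁶` and any real zero `β′ < 1` of `L(s, χ′)`:
`1 − β′ > 1/(5.828 log(qq′))` or `L(1, χ) > 1/(7.735 log q)`. Second case via McCurley's explicit
Landau theorem (`McCurley1984_theorem2_holds`, constant `0.3103… > 1/5.828`) in place of Stark's
inequality for `ζ_{ℚ(√d,√d′)}`; first case via the Lemma-1 machinery
(`Hoffstein1980.lOne_gt_of_ne_zero_window`).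
[cite: Hoffstein1980SiegelTatuzawa, Lemma 3 p. 170 (statement and proof)]
[cite: McCurley1984ZFR, Theorem 2] -/
theorem hoffstein1980_lemma3_holds : hoffstein1980_lemma3 := by
  intro q _ χ q' _ χ' hχp hχq _hχ1 hχ'p hχ'q _hχ'1 hne hq'6 hqq' β' _hβ'1 hz'
  have hqq'r : (q' : ℝ) ≤ q := by exact_mod_cast hqq'
  have hq6 : (10 ^ 6 : ℝ) ≤ q := hq'6.trans hqq'r
  have hq0 : (0 : ℝ) < q := lt_of_lt_of_le (by norm_num) hq6
  have hq'0 : (0 : ℝ) < q' := lt_of_lt_of_le (by norm_num) hq'6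
  have hlogq := Hoffstein1980.log_gt_of_ge_ten6 hq6
  have hlogq' := Hoffstein1980.log_gt_of_ge_ten6 hq'6
  have hlogq0 : 0 < Real.log q := by linarith
  by_cases hA : ∃ β : ℝ, 1 - 1 / (11.657 * Real.log q) ≤ β ∧ β < 1 ∧ χ.LFunction β = 0
  · -- second case of the printed proof: a zero `β` of `L(s, χ)` inside the window
    obtain ⟨β, hβlo, _hβ1, hβz⟩ := hA
    left
    have hdist : q ≠ q' ∨ ∃ h : q = q', h ▸ χ ≠ χ' := by
      by_cases h : q = q'
      · subst h
        refine Or.inr ⟨rfl, fun heq ↦ hne ?_⟩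
        funext n
        rw [show χ = χ' from heq]
      · exact Or.inl h
    have hMc := McCurley1984_theorem2_holds q q' χ χ' hχp hχq hχ'p hχ'q hdist β β' hβz hz'
    rw [ThornerZaman2024.one_div_rOne_mul_eq] at hMc
    set c : ℝ := ThornerZaman2024.landauConst with hcdef
    have hc : (0.31 : ℝ) < c := Hoffstein1980.landauConst_gt
    set M : ℝ := max ((q : ℝ) * q' / 17) 13 with hMdef
    have hqq'13 : (13 : ℝ) ≤ (q : ℝ) * q' := by nlinarith
    have hMle : M ≤ (q : ℝ) * q' :=
      max_le (div_le_self (by positivity) (by norm_num)) hqq'13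
    have hM13 : (13 : ℝ) ≤ M := le_max_right _ _
    have hlogM : Real.log M ≤ Real.log ((q : ℝ) * q') := Real.log_le_log (by linarith) hMle
    have hlogM0 : 0 < Real.log M := Real.log_pos (by linarith)
    have hlogqq' : Real.log ((q : ℝ) * q') = Real.log q + Real.log q' :=
      Real.log_mul hq0.ne' hq'0.ne'
    have hlogle : Real.log ((q : ℝ) * q') ≤ 2 * Real.log q := by
      rw [hlogqq']; linarith [Real.log_le_log hq'0 hqq'r]
    have hlogqq'0 : 0 < Real.log ((q : ℝ) * q') := by rw [hlogqq']; linarith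
    -- `β` is inside McCurley's window
    have hβge : 1 - c / Real.log M ≤ β := by
      have h1 : 1 / (11.657 * Real.log q) ≤ c / Real.log M := by
        rw [div_le_div_iff₀ (by positivity) hlogM0]
        nlinarith [hlogM.trans hlogle]
      linarith
    -- hence `β′` is outside it
    have hβ'lt : β' < 1 - c / Real.log M := by
      by_contra h
      exact absurd hMc (not_lt.2 (le_min hβge (not_lt.1 h)))
    calc 1 / (5.828 * Real.log ((q : ℝ) * q')) < c / Real.log M := by
          rw [div_lt_div_iff₀ (by positivity) hlogM0]
          nlinarith
      _ < 1 - β' := by linarith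
  · -- first case of the printed proof: no zero of `L(s, χ)` in the window
    right
    push Not at hA
    exact Hoffstein1980.lOne_gt_of_ne_zero_window hχp hχq hq6 fun σ h1 h2 ↦ hA σ h1 h2

/-! ### (5) ⇒ (6) in class-number currency -/

/-- **A small class number forces an explicit real zero of `ζ_K` (Hoffstein's (5) ⇒ (6), p. 170, read
through the class number formula as on p. 173 (17)).** Let `K` be an imaginary quadratic field with
`|d_K| ≥ 10⁶` and `h_K ≤ √|d_K|/(7.735 π log|d_K|)`. Then the (continued) Dedekind zeta function
`ζ_K = ζ · L(·, κ)` (`κ` the Kronecker character of `K`, primitive quadratic mod `|d_K|`) has a LARGEST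
real zero `β ∈ [1 − 1/(11.657 log|d_K|), 1)` — no zero of `ζ_K` on `(β, 1)` — and
`1.511 (1 − β) < π h_K/√|d_K|` `(= L(1, κ)`, `w_K = 2)`. (`Hoffstein1980.exists_realZero_of_lOne_le` for
`κ`, the class number formula `L(1, κ) = 2π h_K/(w_K √|d_K|)`
(`Quadratic.LFunction_one_eq_of_discr_neg_of_eq`), and the tree's transfer of real zeros between `ζ_K`
and `L(s, κ)` on `(0, 1)` (`Quadratic.dedekindZetaCont_eq_zero_iff`,
`Quadratic.LFunction_eq_zero_of_realZero`; `dedekindZetaCont` of `DedekindZeta.lean`).)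
[cite: Hoffstein1980SiegelTatuzawa, p. 170 (5)–(6); p. 173 (17)] [cite: NeukirchANT1999, Ch. VII §5 (5.11)] -/
theorem exists_realZero_dedekindZeta_of_classNumber_le (K : Type) [Field K] [NumberField K]
    (h2 : Module.finrank ℚ K = 2) (hd : NumberField.discr K < 0)
    (hD : (10 ^ 6 : ℝ) ≤ (NumberField.discr K).natAbs)
    (hh : (NumberField.classNumber K : ℝ) ≤ Real.sqrt ((NumberField.discr K).natAbs : ℝ) /
      (7.735 * Real.pi * Real.log ((NumberField.discr K).natAbs : ℝ))) :
    ∃ β : ℝ, 1 - 1 / (11.657 * Real.log ((NumberField.discr K).natAbs : ℝ)) ≤ β ∧ β < 1 ∧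
      dedekindZetaCont K β = 0 ∧ (∀ σ : ℝ, β < σ → σ < 1 → dedekindZetaCont K σ ≠ 0) ∧
      1.511 * (1 - β) <
        Real.pi * NumberField.classNumber K / Real.sqrt ((NumberField.discr K).natAbs : ℝ) := by
  classical
  obtain ⟨M, _, κ, hM, hκ, hsq, hprim, hfac⟩ :=
    Literature.NumberTheory.QuadraticFields.Quadratic.exists_primitive_kroneckerChar h2
  have hquad : κ.IsQuadratic := MulChar.isQuadratic_iff_sq_eq_one.2 hsq
  have hM6 : (10 ^ 6 : ℝ) ≤ M := by rw [hM]; exact hD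
  have hM0 : (0 : ℝ) < M := lt_of_lt_of_le (by norm_num) hM6
  -- class number formula, `w_K = 2`
  have hd4 : NumberField.discr K < -4 := by
    have h1 : (10 ^ 6 : ℝ) ≤ ((NumberField.discr K).natAbs : ℤ) := by exact_mod_cast hD
    have h2' : ((NumberField.discr K).natAbs : ℤ) = -NumberField.discr K := by omega
    rw [h2'] at h1
    have : (10 ^ 6 : ℝ) ≤ -(NumberField.discr K : ℝ) := by exact_mod_cast h1
    have : (NumberField.discr K : ℝ) < -4 := by linarith
    exact_mod_cast this
  have hcnf := Literature.NumberTheory.QuadraticFields.Quadratic.LFunction_one_eq_of_discr_neg_of_eq h2 hd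
    hκ (fun s hs ↦ hfac s (by simpa using hs))
  have hw : (NumberField.Units.torsionOrder K : ℝ) = 2 := by
    exact_mod_cast
      Literature.NumberTheory.QuadraticFields.Quadratic.torsionOrder_eq_two_of_discr_lt_neg_four h2 hd4
  have habs : |(NumberField.discr K : ℝ)| = (M : ℝ) := by
    rw [← Int.cast_abs, Int.abs_eq_natAbs, Int.cast_natCast, hM]
  have hL1 : (κ.LFunction 1).re =
      Real.pi * NumberField.classNumber K / Real.sqrt ((NumberField.discr K).natAbs : ℝ) := by
    rw [hcnf, hw, habs, Complex.ofReal_re, ← hM]; ring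
  -- (5): `L(1, κ) ≤ 1/(7.735 log M)`
  have hlog : 0 < Real.log M := Real.log_pos (by linarith)
  have hsq0 : 0 < Real.sqrt (M : ℝ) := Real.sqrt_pos.2 hM0
  have hπ := Real.pi_pos
  have h5 : (κ.LFunction 1).re ≤ 1 / (7.735 * Real.log M) := by
    rw [hL1, ← hM]
    rw [← hM] at hh
    rw [div_le_div_iff₀ hsq0 (by positivity)]
    rw [le_div_iff₀ (by positivity)] at hh
    nlinarith [Real.mul_self_sqrt hM0.le]
  obtain ⟨β, hz, hβw, hβ1, hne, hbound⟩ := Hoffstein1980.exists_realZero_of_lOne_le hprim hquad hM6 h5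
  have hlog13 : (13 : ℝ) < Real.log M := by
    have h19 : Real.log ((2 : ℝ) ^ 19) ≤ Real.log M :=
      Real.log_le_log (by positivity) (le_trans (by norm_num) hM6)
    rw [Real.log_pow] at h19
    push_cast at h19
    linarith [Real.log_two_gt_d9]
  have hβ0 : 0 < β := by
    have : 1 / (11.657 * Real.log M) < 1 := by
      rw [div_lt_one (by positivity)]; nlinarith
    linarith
  refine ⟨β, by rw [← hM]; exact hβw, hβ1, ?_, fun σ h1 h2' hζ ↦ ?_, by rw [← hL1]; exact hbound⟩
  · have hβ1' : (β : ℂ) ≠ 1 := fun h ↦ by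
      have := congrArg Complex.re h; simp at this; linarith
    exact (Literature.NumberTheory.QuadraticFields.Quadratic.dedekindZetaCont_eq_zero_iff hκ hfac
      hβ1').2 (Or.inr hz)
  · exact hne σ h1 h2'
      (Literature.NumberTheory.QuadraticFields.Quadratic.LFunction_eq_zero_of_realZero hκ hfac
        (by linarith) h2' hζ)

end Literature.NumberTheory.LFunctions

end
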